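import Summits.SmoothPoincare4.SmoothPoincare4.Theses.TwistorRealLines
import HarnessLib

/-!
# Line `birth` — BC3 skeleton for the crux `TwistorRealLines.TwistorSymplecticExistence` (stmt-SmoothPoincare4-5326)

Route `route-SmoothPoincare4-TwistorRealLines` (rank-3 crux, the route's `E`), decl
`Summit.SmoothPoincare4.SmoothPoincare4.Theses.TwistorRealLines.TwistorSymplecticExistence`:

  every smooth homotopy 4-sphere `M` (Hausdorff, second countable, `C^∞` atlas on `ℝ⁴`, `M ≃ₕ S⁴` —
  the bare carriers of `SmoothPoincare4`) carries a smooth orientation `o` and a `C^∞` Riemannian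
  metric `g` (with its Levi-Civita connection) of POSITIVE TWISTOR-SYMPLECTIC (= positive DEFINITE)
  TYPE: in every `o`-positive `g`-orthonormal frame `e`, Hamilton's curvature blocks
  `A = (R(φᵢ,φⱼ))` (the `Λ⁺Λ⁺` block, `= 2(s/12 + W⁺)` in an orthonormal basis of `Λ⁺`) and
  `B = (R(φᵢ,ψⱼ))` (the `Λ⁺Λ⁻` block, `≅ Ric₀ : Λ⁺ → Λ⁻`) satisfy `|Bᵀu| < |Au|` and `uᵀAu > 0`
  for `u ≠ 0` — Fine–Krasnov–Panov's Riemannian inequality `(s/12 + W⁺)² > Ric₀* Ric₀` with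
  `s/12 + W⁺ > 0` (arXiv:1312.2831, Thm. 20 + Conj. 21: the Levi-Civita connection on `Λ⁺` is a
  POSITIVE DEFINITE connection; Reznikov's closed 2-form on the twistor space is symplectic Fano,
  Prop. 15).

Standing of the crux (route file, 2026-08-17): `SmoothPoincare4 → E` (round metric: `B = 0`,
`A = (s/6)·Id > 0`); `E → SmoothPoincare4` is FKP Conj. 21 on homotopy spheres (open; the route's
crux `TwistorSymplecticRigidity`). No `Cruxes/TwistorSymplecticExistence/Disproof.lean`, no landed
`Theorems/TwistorSymplecticExistence/Negative/*`; negatives index of the summit empty at the last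
reading available to this seat (route header rev 5).

## The line: SELF-DUAL POSITIVITY first, then CONFORMAL TAMING of the Ricci block

FKP's inequality couples two halves of the curvature of `Λ⁺`: its self-dual part `A = s/12 + W⁺`
(which must be positive definite — the "Fano sign") and its anti-self-dual part `B ≅ Ric₀` (which
must be dominated by `A`). The two halves behave differently under the two classical
metric-improving mechanisms of 4-dimensional conformal geometry, and the line cuts `E` along
exactly that seam:

* `stub_selfDualPositiveMetric` — **OPEN (the topological stub): every smooth homotopy 4-sphere
  carries an orientation `o` and a Riemannian metric whose block `A` is positive definite in every
  `o`-positive orthonormal frame**, i.e. `s/12 + W⁺ > 0` pointwise ("A-positive", the Fano half of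
  `E` alone: `E` with the `B`-inequality dropped). Where it sits: `E ⇒` this (drop a conjunct) `⇒`
  Richard–Seshadri's half-PIC condition `PIC₊` (`W⁺ < s/6`: for trace-free `W⁺` with eigenvalues
  `w₁ ≤ w₂ ≤ w₃`, `w₁ > −s/12` forces `w₃ ≤ −2w₁ < s/6`, the computation of FKP's proof of Thm. 22)
  `⇒` positive scalar curvature (`tr A = s/2 > 0`; item `BachCriticalElement.PscOnHomotopySpheres`,
  stmt-SmoothPoincare4-4393). Each of these is implied by `SPC4` and none is known to imply it: a
  Ricci-flow-with-surgery classification of compact `PIC₊` 4-manifolds is an open question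
  (Richard–Seshadri 2015, end of §1: "it might be interesting to study if a Ricci flow with surgery
  procedure holds for PIC₊ manifolds … might yield a diffeomorphism classification"; shrinking
  solitons: Cao–Xie 2023), so the stub is NOT the summit in curvature clothing. Known structure:
  A-positivity forces `b₂⁺ = 0` (Bochner on self-dual harmonic 2-forms, Richard–Seshadri Prop. 1.4)
  — vacuous on a homotopy sphere — and, unlike `E`, it is an open CONVEX `SO(4)`-invariant cone
  containing the curvature of `S³ × ℝ` in its interior, hence stable under connected sums
  (Micallef–Wang / Richard–Seshadri Prop. 1.3; Hoelzel's surgery theorem in codimension 4) but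
  BORDERLINE for `S² × ℝ²` (`A ∝ diag(1/2, 0, 0)`), so not under 1-surgeries: the same wall that
  keeps positive scalar curvature open on homotopy 4-spheres. By Gursky's conformal-eigenvalue
  trick the stub is a statement about CONFORMAL CLASSES: `[g]` contains an A-positive metric iff
  the first eigenvalue of `−6Δ_g + s_g + 12 λ_min(W⁺_g)` is positive (a conformal invariant, as
  for the Yamabe sign). Why it might fail: an exotic `Σ` may force `λ_min(W⁺) ≤ −s/12` somewhere
  for every metric — an obstruction of a kind no current invariant detects (`b₂⁺ = 0` is the only
  known consequence). Sources: FineKrasnovPanov2014 (arXiv:1312.2831) Thm. 20, Conj. 21, proof of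
  Thm. 22, Rem. 23; RichardSeshadri2015 (arXiv:1311.5256, doi:10.1007/s00229-015-0790-2) Thm. 1.1,
  Props. 1.2–1.4 and §1 closing remarks; CaoXie2023 (arXiv:2211.09091); Gursky2000; Hoelzel2016.
  Size: open problem (strictly between `E` and PSC-on-homotopy-spheres).
* `stub_conformalTaming` — **OPEN (the analytic stub, a fully nonlinear conformal PDE statement):
  on a smooth homotopy 4-sphere, an A-positive Riemannian metric `g₀` (w.r.t. `o`) is pointwise
  conformal, `g = e^{2w} g₀` with `w` smooth, to a metric of positive TAME type w.r.t. `o`**: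
  `⟨Au,u⟩ > |Bᵀu|·|u|` and `⟨Au,u⟩ > 0` for `u ≠ 0` in `o`-positive orthonormal frames — the
  Fine–Panov TAME inequality `|⟨A(θ),θ⟩| > |B(θ)||θ|` with `det A > 0` (Fine–Panov 2009 Thm. 4.4 =
  Fine 2017 Thm. 1: then Reznikov's form TAMES the Atiyah–Hitchin–Singer structure `J₊`, which is
  the input the route's engine `RealCongruenceRigidity` wants — twistor lines `J₊`-holomorphic for
  a tamed `J₊`). Why this cut: the conclusion asks to shrink the Ricci block `B ≅ Ric₀` below the
  self-dual block inside a conformal class, and `Ric₀` is exactly what a conformal factor moves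
  (by the trace-free Hessian of `w`), while `W⁺` is conformally covariant and the A-positivity of
  the class is preserved with margin by Gursky's first eigenfunction; the tame cone is CONVEX in
  the Schouten tensor at fixed `W⁺` (`⟨Au,u⟩` is affine in `s`, `|Bᵀu|` convex in `Ric₀`), so the
  target is an (at worst degenerate) elliptic convex-cone condition of `σ₂`-Yamabe type — for
  `W⁺ = 0` it is precisely 2-POSITIVITY OF THE SCHOUTEN TENSOR `Ric − (s/6)g` (sum of the two
  smallest eigenvalues positive), a cone between `Γ₃⁺` and the `Γ₂⁺` of Chang–Gursky–Yang's
  Theorem A. The necessary integral condition obtained by integrating the pointwise inequality,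
  `∫(σ₂(A_g) + ½|W⁺|²) dV > 0`, is `∝ 2χ + 3τ = 4 > 0`, automatic on a homotopy sphere (it is
  FKP's `p₁(Λ⁺) > 0`). Restricted to homotopy spheres on purpose: on `2ℂP̄²` reversed
  LeBrun–Poon metrics (`W⁺ ≡ 0`, `s > 0`) are A-positive while FKP Conj. 21 forbids definite type,
  an obstruction expected to come from the non-algebraic twistor space — absent for homotopy
  spheres, whose twistor spaces are diffeomorphic to `ℂP³` (route support `TwistorLift`). Already
  meaningful and killable on `S⁴` itself: "every conformal class on `S⁴` containing a metric with
  `s/12 + W⁺ > 0` contains a tame-type metric". Why it might fail: a further conformally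
  invariant obstruction (as `∫σ₂ > 0` is for `Γ₂⁺`) or loss of ellipticity at the degenerate
  directions of the tame cone; a single A-positive class on `S⁴` with no tame member refutes it
  without touching SPC4. Sources: FinePanov2009 Thm. 4.4 / Fine2017 (arXiv:1602.03829) Thm. 1,
  Def. 2; ChangGurskyYang2002 Thm. A (the `Γ₂⁺` analogue); GurskyViaclovsky2003; Gursky2000;
  FineKrasnovPanov2014 §2 (`p₁ = 2χ + 3τ`). Size: open (new PDE problem with named analogues).
* `TwistorSymplecticExistence_of : Sig.stub_selfDualPositiveMetric → Sig.stub_conformalTaming →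
  TwistorSymplecticExistence` — the composition, sorry-free, concluding the route decl BY NAME:
  stub 1 gives `(o, g₀)`, stub 2 gives the conformal tame metric `g`, and TAME ⇒ DEFINITE is the
  Cauchy–Schwarz step `⟨Au,u⟩² ≤ |Au|²|u|²` (Fine 2017, p. 3: the tame inequality is "another,
  stronger, curvature inequality"), proved here as `definite_of_tame`; and
  `TwistorSymplecticExistence_proof : TwistorSymplecticExistence` — the skeleton in its final
  shape (depends on `sorryAx` only through the two `stub_*`).

Vocabulary is the route file's (no new notions): `PseudoRiemannianMetric`, `HasLeviCivita`,
`leviCivita`, `IsRiemannian`, `IsOrthonormalFrame` (Lorentzian/…, Riemannian/IsotropicCurvature),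
Hamilton's `blockA`/`blockB` (Riemannian/CurvatureDecomposition), `SmoothOrientation` with the
crux's own `o`-positivity clause `0 < someVector (o x) (e ∘ Fin.cast _)`, and the conformality
clause `g = e^{2w} g₀` written exactly as in `Cruxes/ExistRicPos/Lines/birth.lean`.

## Disproof used / negatives

None exists for this crux at registration (no `Disproof.lean`, no Negative lemmas); the route's
negatives index is empty. The stub set honours the crux's recorded "why it might fail"
(s-dominated pointwise cone is PSC-hard; pointwise cones do not propagate through the
codimension-2/3 surgeries relating `Σ` to `S⁴`, Hoelzel2016): that obstruction is isolated in
stub 1 (whose cone is surgery-stable in codimension 4 only), and stub 2 carries no topology.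

## BC3 audit

See `Lines/birth.md` and the seat's NOTES.md `birth-certificate:` for the raw `lean check` output
(sorries = 2 = stub count, zero elsewhere) and the four probes `stub → crux`, `stub → SmoothPoincare4`
by `first | exact? | simpa [Sig.stub] | (unfold Sig.stub; simpa) | aesop` (all FAIL).
-/

set_option linter.dupNamespace false
set_option linter.unusedVariables false

noncomputable section

namespace Summit.SmoothPoincare4.SmoothPoincare4.Cruxes.TwistorSymplecticExistence.Birth

open scoped Manifold ContDiff Topology BigOperators
open Matrix
open ContinuousMap
open Literature.Geometry.Lorentzian (PseudoRiemannianMetric)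
open Literature.Geometry.Lorentzian.PseudoRiemannianMetric
open Literature.Topology.FourManifolds
open Summit.SmoothPoincare4.SmoothPoincare4.Theses.TwistorRealLines (TwistorSymplecticExistence)

/-- Local notation: the model space `ℝ⁴`. -/
local notation "ℝ⁴" => EuclideanSpace ℝ (Fin 4)
/-- Local notation: the round unit sphere `S⁴ ⊂ ℝ⁵` with Mathlib's `C^∞` structure. -/
local notation "𝕊⁴" => (Metric.sphere (0 : EuclideanSpace ℝ (Fin 5)) 1)

/-! ### Stub signatures (`Sig.stub_*`, so that the hypothesis heads of
`TwistorSymplecticExistence_of` carry the registered stub names; every clause is route-file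
vocabulary, nothing is hidden behind a local predicate) -/

/-- STUB 1 — AN A-POSITIVE METRIC ON EVERY HOMOTOPY 4-SPHERE (the Fano / self-dual half of `E`).
For every smooth homotopy 4-sphere `M` there are a smooth orientation `o` and a `C^∞` Riemannian
metric `g` (with its Levi-Civita connection) such that in every `o`-positive `g`-orthonormal frame
Hamilton's block `A = (R(φᵢ,φⱼ))` is positive definite: `uᵀ A u > 0` for `u ≠ 0`; equivalently
`s/12 + W⁺ > 0` pointwise (FKP's sign condition), which implies half-PIC `W⁺ < s/6`
(Richard–Seshadri's `PIC₊`) and `s > 0`. [cite: FineKrasnovPanov2014, Thm. 20, Conj. 21, Thm. 22]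
[cite: RichardSeshadri2015, Thm. 1.1, Props. 1.2–1.4] -/
def Sig.stub_selfDualPositiveMetric : Prop :=
  ∀ (M : Type) [TopologicalSpace M] [T2Space M] [SecondCountableTopology M]
    [ChartedSpace ℝ⁴ M] [IsManifold (𝓡 4) ∞ M],
    M ≃ₕ 𝕊⁴ →
      ∃ (o : SmoothOrientation (𝓡 4) M)
        (g : PseudoRiemannianMetric (𝓡 4) ∞ ℝ⁴ (TangentSpace (𝓡 4) : M → Type _)),
        ∃ _ : g.HasLeviCivita, g.IsRiemannian ∧
          ∀ (x : M) (e : Fin 4 → TangentSpace (𝓡 4) x), g.IsOrthonormalFrame x e →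
            0 < Module.Ray.someVector (o x) (fun i => e (Fin.cast finrank_euclideanSpace_fin i)) →
              ∀ u : Fin 3 → ℝ, u ≠ 0 → 0 < u ⬝ᵥ (g.blockA g.leviCivita x e *ᵥ u)

/-- STUB 2 — CONFORMAL TAMING OF THE RICCI BLOCK (the analytic half). On a smooth homotopy
4-sphere `M` with a smooth orientation `o`, every `C^∞` Riemannian metric `g₀` (with its
Levi-Civita connection) which is A-positive w.r.t. `o` (stub 1's pointwise condition) is pointwise
conformal — `g = e^{2w} g₀`, `w : M → ℝ` smooth — to a `C^∞` Riemannian metric `g` of positive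
TAME type w.r.t. `o`: in every `o`-positive `g`-orthonormal frame and for every `u ≠ 0`,
`|u ᵥ* B|² · |u|² < (uᵀ A u)²` and `uᵀ A u > 0` (Fine–Panov's tame inequality
`|⟨A(θ),θ⟩| > |B(θ)||θ|` with `det A > 0`, squared; then Reznikov's 2-form tames `J₊`).
[cite: FinePanov2009, Thm. 4.4] [cite: Fine2017, Thm. 1, Def. 2]
[cite: ChangGurskyYang2002, Thm. A] -/
def Sig.stub_conformalTaming : Prop :=
  ∀ (M : Type) [TopologicalSpace M] [T2Space M] [SecondCountableTopology M]
    [ChartedSpace ℝ⁴ M] [IsManifold (𝓡 4) ∞ M],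
    M ≃ₕ 𝕊⁴ →
      ∀ (o : SmoothOrientation (𝓡 4) M)
        (g₀ : PseudoRiemannianMetric (𝓡 4) ∞ ℝ⁴ (TangentSpace (𝓡 4) : M → Type _))
        [g₀.HasLeviCivita],
        g₀.IsRiemannian →
        (∀ (x : M) (e : Fin 4 → TangentSpace (𝓡 4) x), g₀.IsOrthonormalFrame x e →
            0 < Module.Ray.someVector (o x) (fun i => e (Fin.cast finrank_euclideanSpace_fin i)) →
              ∀ u : Fin 3 → ℝ, u ≠ 0 → 0 < u ⬝ᵥ (g₀.blockA g₀.leviCivita x e *ᵥ u)) →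
          ∃ g : PseudoRiemannianMetric (𝓡 4) ∞ ℝ⁴ (TangentSpace (𝓡 4) : M → Type _),
            ∃ _ : g.HasLeviCivita, g.IsRiemannian ∧
              (∃ w : M → ℝ, ContMDiff (𝓡 4) 𝓘(ℝ) ∞ w ∧
                ∀ (x : M) (v v' : TangentSpace (𝓡 4) x),
                  g.val x v v' = Real.exp (2 * w x) * g₀.val x v v') ∧
              ∀ (x : M) (e : Fin 4 → TangentSpace (𝓡 4) x), g.IsOrthonormalFrame x e →
                0 < Module.Ray.someVector (o x)
                    (fun i => e (Fin.cast finrank_euclideanSpace_fin i)) →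
                  ∀ u : Fin 3 → ℝ, u ≠ 0 →
                    (u ᵥ* g.blockB g.leviCivita x e) ⬝ᵥ (u ᵥ* g.blockB g.leviCivita x e) * (u ⬝ᵥ u) <
                        (u ⬝ᵥ (g.blockA g.leviCivita x e *ᵥ u)) ^ 2 ∧
                      0 < u ⬝ᵥ (g.blockA g.leviCivita x e *ᵥ u)

/-! ### The two registered stubs (`sorry` lives ONLY here) -/

/-- Registered stub 1 (topological half — an A-positive (`s/12 + W⁺ > 0`) metric on every smooth
homotopy 4-sphere; load-bearing for exotic candidates). Sources: FineKrasnovPanov2014 Thm. 20 /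
Conj. 21 / proof of Thm. 22; RichardSeshadri2015 Props. 1.2–1.4 and §1 (PIC₊ classification open);
CaoXie2023; Hoelzel2016. -/
theorem stub_selfDualPositiveMetric : Sig.stub_selfDualPositiveMetric := by
  sorry

/-- Registered stub 2 (analytic half — conformal taming of the Ricci block on an A-positive
homotopy 4-sphere; already open and killable on `S⁴`). Sources: FinePanov2009 Thm. 4.4 / Fine2017
Thm. 1; ChangGurskyYang2002 Thm. A; GurskyViaclovsky2003; Gursky2000. -/
theorem stub_conformalTaming : Sig.stub_conformalTaming := by
  sorry

/-! ### The seam: TAME ⇒ DEFINITE (Cauchy–Schwarz), proved -/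

/-- For `u ≠ 0`, `0 < u ⬝ᵥ u` on `Fin 3 → ℝ`. [folklore] -/
theorem dotProduct_self_pos_of_ne_zero {u : Fin 3 → ℝ} (hu : u ≠ 0) : 0 < u ⬝ᵥ u := by
  have h0 : 0 ≤ u ⬝ᵥ u := by
    unfold dotProduct
    exact Finset.sum_nonneg fun i _ => mul_self_nonneg (u i)
  rcases h0.lt_or_eq with h | h
  · exact h
  · exact absurd (dotProduct_self_eq_zero.mp h.symm) hu

/-- **Cauchy–Schwarz for Hamilton's block `A`**: `(uᵀ A u)² ≤ (u ⬝ᵥ u) · |A u|²`. [folklore] -/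
theorem dotProduct_mulVec_sq_le (A : Matrix (Fin 3) (Fin 3) ℝ) (u : Fin 3 → ℝ) :
    (u ⬝ᵥ (A *ᵥ u)) ^ 2 ≤ (u ⬝ᵥ u) * ((A *ᵥ u) ⬝ᵥ (A *ᵥ u)) := by
  have h := Finset.sum_mul_sq_le_sq_mul_sq Finset.univ u (A *ᵥ u)
  simpa only [dotProduct, pow_two] using h

/-- **The Fine–Panov tame inequality implies the Fine–Krasnov–Panov definite inequality**
(Fine 2017, p. 3: taming is "another, stronger, curvature inequality"): if
`|u ᵥ* B|² · |u|² < (uᵀ A u)²` for some `u ≠ 0` then `|u ᵥ* B|² < |A u|²`, since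
`(uᵀ A u)² ≤ |u|² |A u|²` by Cauchy–Schwarz. [cite: Fine2017, Thm. 1 and p. 3] -/
theorem definite_of_tame {A B : Matrix (Fin 3) (Fin 3) ℝ} {u : Fin 3 → ℝ} (hu : u ≠ 0)
    (h : (u ᵥ* B) ⬝ᵥ (u ᵥ* B) * (u ⬝ᵥ u) < (u ⬝ᵥ (A *ᵥ u)) ^ 2) :
    (u ᵥ* B) ⬝ᵥ (u ᵥ* B) < (A *ᵥ u) ⬝ᵥ (A *ᵥ u) := by
  have hcs := dotProduct_mulVec_sq_le A u
  have hu' := dotProduct_self_pos_of_ne_zero hu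
  have h' : (u ⬝ᵥ u) * ((u ᵥ* B) ⬝ᵥ (u ᵥ* B)) < (u ⬝ᵥ u) * ((A *ᵥ u) ⬝ᵥ (A *ᵥ u)) := by
    rw [mul_comm (u ⬝ᵥ u)]
    exact h.trans_le hcs
  exact lt_of_mul_lt_mul_left h' hu'.le

/-! ### Composition: the two stubs prove the crux BY NAME (no `sorry` below this line) -/

/-- **The line closes the crux BY NAME modulo the two registered stubs.** Given a smooth homotopy
4-sphere `M`, stub 1 supplies `(o, g₀)` with `s/12 + W⁺ > 0`; stub 2 supplies a conformal metric
`g` of positive tame type; `definite_of_tame` turns the tame inequality into FKP's definite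
inequality frame by frame, which is the crux's pointwise clause verbatim.
[cite: FineKrasnovPanov2014, Thm. 20] [cite: Fine2017, Thm. 1] -/
theorem TwistorSymplecticExistence_of :
    Sig.stub_selfDualPositiveMetric → Sig.stub_conformalTaming → TwistorSymplecticExistence := by
  intro h₁ h₂
  unfold TwistorSymplecticExistence
  intro M _ _ _ _ _ he
  -- stub 1: an orientation and an A-positive metric
  obtain ⟨o, g₀, hLC₀, hg₀, hA⟩ := h₁ M he
  -- stub 2: a conformal metric of positive tame type
  obtain ⟨g, hLC, hg, _hconf, hT⟩ := h₂ M he o g₀ hg₀ hA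
  refine ⟨o, g, hLC, hg, ?_⟩
  intro x e he hpos u hu
  obtain ⟨ht, hq⟩ := hT x e he hpos u hu
  -- tame ⇒ definite (Cauchy–Schwarz), and `uᵀ A u > 0` is carried over
  exact ⟨definite_of_tame hu ht, hq⟩

/-- **THE SKELETON THEOREM.** The crux
`Summit.SmoothPoincare4.SmoothPoincare4.Theses.TwistorRealLines.TwistorSymplecticExistence`,
concluded BY NAME from the two DECLARED stubs `stub_selfDualPositiveMetric`, `stub_conformalTaming`
(the only `sorry`s of the file) through the sorry-free composition
`TwistorSymplecticExistence_of`. [cite: FineKrasnovPanov2014, Thm. 20] -/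
theorem TwistorSymplecticExistence_proof : TwistorSymplecticExistence :=
  TwistorSymplecticExistence_of stub_selfDualPositiveMetric stub_conformalTaming

end Summit.SmoothPoincare4.SmoothPoincare4.Cruxes.TwistorSymplecticExistence.Birth

end
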